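import Mathlib
import Summits.Ventures.PercRepro2.ThreeTermPartStar

/-!
# Three-terminal parts, V: every star type pattern passes the typed Harris check — the typed star
base of any type pattern from the partition-world certificate
(blind cell PercRepro2, night-3 g29, 2026-08-29; `proofs/NIGHT3-CERT.md` §38 — g28's NOT DONE (iv))

`ThreeTermPartStar.lean` derives the typed Harris condition of the `(2,2,2)`-star law from g28's `72`
evaluations.  Here the typed Harris condition of the star law of ANY type pattern `(t₀, t₁, t₂)` is
reduced to an INTEGER statement `starHarrisZ t₀ t₁ t₂` — the nine Harris slacks have coefficients in
`{0, ±1/2, ±1}`, so twice them (`hq2`, `hq_eq_hq2`) are integers and the `72` typed sums of a pattern are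
half of integer sums over the `512` star-configuration triples — which the kernel decides
(`starHarrisZ_all`: all eight patterns with types in `{1, 2}`, one `decide` each).  Hence

* **`typedHarris_star`**: the star law of every type pattern in `{1, 2}³` satisfies typed Harris;
* **`typedCount_star_nonneg`**: for a star at an unmarked vertex with any types in `{1, 2}` on its three
  edges, if the part graph's table lies in the Harris cone of the pattern world, the typed base of
  core + star is nonnegative — the `(2,2,2)`-hard step of p739048 / `typedCount_star222_nonneg'` for
  all star type patterns, with the certificate read on the core's partition table.

Own work; standard axioms (the finite checks are `decide`, no `native_decide`).
-/

namespace Summit.Ventures.PercRepro2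

open ThreeTerm TypedStar

namespace Part

section Types

/-- The symmetric indicator of the unordered pair `{a, b}`. -/
def pairInd (a b p q : Fin 5) : ℤ := if (p = a ∧ q = b) ∨ (p = b ∧ q = a) then 1 else 0

/-- Twice the bilinear coefficients `hq` of the nine Harris slacks, as integers. -/
def hq2 (s : Fin 9) (p q : Fin 5) : ℤ :=
  match s with
  | 0 => pairInd 0 4 p q + pairInd 3 4 p q - pairInd 1 2 p q
  | 1 => pairInd 0 4 p q + pairInd 2 4 p q - pairInd 1 3 p q
  | 2 => pairInd 0 4 p q + pairInd 1 4 p q - pairInd 2 3 p q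
  | 3 => pairInd 0 4 p q - pairInd 1 2 p q - pairInd 1 3 p q
  | 4 => pairInd 0 4 p q - pairInd 1 2 p q - pairInd 2 3 p q
  | 5 => pairInd 0 4 p q - pairInd 1 3 p q - pairInd 2 3 p q
  | 6 => pairInd 0 1 p q + pairInd 0 4 p q - pairInd 2 3 p q
  | 7 => pairInd 0 2 p q + pairInd 0 4 p q - pairInd 1 3 p q
  | 8 => pairInd 0 3 p q + pairInd 0 4 p q - pairInd 1 2 p q

/-- `hq` is half of `hq2`. -/
lemma hq_eq_hq2 (s : Fin 9) (p q : Fin 5) : hq s p q = (hq2 s p q : ℚ) / 2 := by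
  fin_cases s <;> fin_cases p <;> fin_cases q <;> simp [hq, sym, hq2, pairInd] <;> norm_num

/-- The typed triples of star configurations with type pattern `(t₀, t₁, t₂)`. -/
def typedT (t₀ t₁ t₂ : ℕ) (i j k : Fin 8) : Prop :=
  bit 0 i + bit 0 j + bit 0 k = t₀ ∧ bit 1 i + bit 1 j + bit 1 k = t₁ ∧ bit 2 i + bit 2 j + bit 2 k = t₂

/-- `typedT` is decidable. -/
instance (t₀ t₁ t₂ : ℕ) (i j k : Fin 8) : Decidable (typedT t₀ t₁ t₂ i j k) := by
  unfold typedT; infer_instance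

/-- **The integer typed Harris sums of a star pattern**: for every pattern `a` and slack `s`, the sum
over the star-configuration triples of type `(t₀, t₁, t₂)` with clique pattern `a` in the first copy of
`hq2` at the partitions of the other two copies is nonnegative. -/
def starHarrisZ (t₀ t₁ t₂ : ℕ) : Prop :=
  ∀ a : Fin 8, ∀ s : Fin 9, (0 : ℤ) ≤ ∑ a' : Fin 8, ∑ b' : Fin 8, ∑ c' : Fin 8,
    if typedT t₀ t₁ t₂ a' b' c' ∧ clique a' = a then hq2 s (π8 b') (π8 c') else 0

/-- **Typed Harris of a star law from its integer sums.** -/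
theorem typedHarris_star_of {t₀ t₁ t₂ : ℕ} (h : starHarrisZ t₀ t₁ t₂) :
    TypedHarris πpat (starLaw t₀ t₁ t₂) := by
  intro a s
  unfold starLaw
  -- move the generator coefficients inside and collapse the pattern fibres
  have step : ∀ b c : Fin 8, hq s (πpat b) (πpat c) *
      (∑ a' : Fin 8, ∑ b' : Fin 8, ∑ c' : Fin 8,
        if ((bit 0 a' + bit 0 b' + bit 0 c' = t₀ ∧ bit 1 a' + bit 1 b' + bit 1 c' = t₁ ∧
            bit 2 a' + bit 2 b' + bit 2 c' = t₂) ∧ (clique a' = a ∧ clique b' = b ∧ clique c' = c))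
          then (1 : ℚ) else 0) =
      ∑ a' : Fin 8, ∑ b' : Fin 8, ∑ c' : Fin 8,
        if clique b' = b ∧ clique c' = c then
          (if typedT t₀ t₁ t₂ a' b' c' ∧ clique a' = a then hq s (πpat b) (πpat c) else 0) else 0 := by
    intro b c
    simp only [Finset.mul_sum]
    refine Finset.sum_congr rfl fun a' _ => Finset.sum_congr rfl fun b' _ =>
      Finset.sum_congr rfl fun c' _ => ?_
    simp only [typedT]
    split_ifs <;> simp_all
  simp only [step]
  rw [sum5_comm]
  simp only [sum_clique_fibre, πpat_clique]
  -- the rational sum is half of the integer sum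
  have hZ : (0 : ℚ) ≤ ((∑ a' : Fin 8, ∑ b' : Fin 8, ∑ c' : Fin 8,
      if typedT t₀ t₁ t₂ a' b' c' ∧ clique a' = a then hq2 s (π8 b') (π8 c') else 0 : ℤ) : ℚ) / 2 := by
    have hz : (0 : ℚ) ≤ ((∑ a' : Fin 8, ∑ b' : Fin 8, ∑ c' : Fin 8,
        if typedT t₀ t₁ t₂ a' b' c' ∧ clique a' = a then hq2 s (π8 b') (π8 c') else 0 : ℤ) : ℚ) := by
      exact_mod_cast h a s
    exact div_nonneg hz (by norm_num)
  refine le_of_le_of_eq hZ ?_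
  push_cast
  simp only [Finset.sum_div]
  refine Finset.sum_congr rfl fun a' _ => Finset.sum_congr rfl fun b' _ =>
    Finset.sum_congr rfl fun c' _ => ?_
  rw [hq_eq_hq2]
  split_ifs <;> simp

set_option maxRecDepth 100000 in
/-- The integer check for the star type pattern `(1, 1, 1)` (one `decide`). -/
theorem starHarrisZ_111 : starHarrisZ 1 1 1 := by
  unfold starHarrisZ; decide

set_option maxRecDepth 100000 in
/-- The integer check for the star type pattern `(1, 1, 2)` (one `decide`). -/
theorem starHarrisZ_112 : starHarrisZ 1 1 2 := by
  unfold starHarrisZ; decide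

set_option maxRecDepth 100000 in
/-- The integer check for the star type pattern `(1, 2, 1)` (one `decide`). -/
theorem starHarrisZ_121 : starHarrisZ 1 2 1 := by
  unfold starHarrisZ; decide

set_option maxRecDepth 100000 in
/-- The integer check for the star type pattern `(1, 2, 2)` (one `decide`). -/
theorem starHarrisZ_122 : starHarrisZ 1 2 2 := by
  unfold starHarrisZ; decide

set_option maxRecDepth 100000 in
/-- The integer check for the star type pattern `(2, 1, 1)` (one `decide`). -/
theorem starHarrisZ_211 : starHarrisZ 2 1 1 := by
  unfold starHarrisZ; decide

set_option maxRecDepth 100000 in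
/-- The integer check for the star type pattern `(2, 1, 2)` (one `decide`). -/
theorem starHarrisZ_212 : starHarrisZ 2 1 2 := by
  unfold starHarrisZ; decide

set_option maxRecDepth 100000 in
/-- The integer check for the star type pattern `(2, 2, 1)` (one `decide`). -/
theorem starHarrisZ_221 : starHarrisZ 2 2 1 := by
  unfold starHarrisZ; decide

set_option maxRecDepth 100000 in
/-- The integer check for the star type pattern `(2, 2, 2)` (one `decide`). -/
theorem starHarrisZ_222 : starHarrisZ 2 2 2 := by
  unfold starHarrisZ; decide

/-- **Every star type pattern with types in `{1, 2}` passes the integer check.** -/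
theorem starHarrisZ_all (t₀ t₁ t₂ : ℕ) (h₀ : t₀ = 1 ∨ t₀ = 2) (h₁ : t₁ = 1 ∨ t₁ = 2)
    (h₂ : t₂ = 1 ∨ t₂ = 2) : starHarrisZ t₀ t₁ t₂ := by
  rcases h₀ with rfl | rfl <;> rcases h₁ with rfl | rfl <;> rcases h₂ with rfl | rfl
  · exact starHarrisZ_111
  · exact starHarrisZ_112
  · exact starHarrisZ_121
  · exact starHarrisZ_122
  · exact starHarrisZ_211
  · exact starHarrisZ_212
  · exact starHarrisZ_221
  · exact starHarrisZ_222

/-- **Typed Harris holds for the star law of every type pattern in `{1, 2}³`.** -/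
theorem typedHarris_star (t₀ t₁ t₂ : ℕ) (h₀ : t₀ = 1 ∨ t₀ = 2) (h₁ : t₁ = 1 ∨ t₁ = 2)
    (h₂ : t₂ = 1 ∨ t₂ = 2) : TypedHarris πpat (starLaw t₀ t₁ t₂) :=
  typedHarris_star_of (starHarrisZ_all t₀ t₁ t₂ h₀ h₁ h₂)

end Types

section Main

variable {V : Type*} {E : Type*} [Fintype E] [DecidableEq E] [DecidableEq V]
variable {ends : E → Sym2 V} {u t₁ t₂ t₃ : V} {e₁ e₂ e₃ : E}
  (he₁ : ends e₁ = s(u, t₁)) (he₂ : ends e₂ = s(u, t₂)) (he₃ : ends e₃ = s(u, t₃))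
  (ht₁ : t₁ ≠ u) (ht₂ : t₂ ≠ u) (ht₃ : t₃ ≠ u) (h12 : t₁ ≠ t₂) (h13 : t₁ ≠ t₃) (h23 : t₂ ≠ t₃)
  (hd12 : e₁ ≠ e₂) (hd13 : e₁ ≠ e₃) (hd23 : e₂ ≠ e₃)
  (hS : ∀ e, e ∈ ({e₁, e₂, e₃} : Finset E) ↔ e ∈ touches ends {u})

include he₁ he₂ he₃ ht₁ ht₂ ht₃ h12 h13 h23 hd12 hd13 hd23 hS in
/-- **The typed star base of any type pattern from the partition-world certificate**: for a star at an
unmarked vertex `u` with types in `{1, 2}` on its three edges, if the part graph's table lies in the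
Harris cone of the pattern world, the typed base of core + star is nonnegative. -/
theorem typedCount_star_nonneg {o a₁ a₂ a₃ b : V} (ho : o ≠ u) (ha₁ : a₁ ≠ u) (ha₂ : a₂ ≠ u)
    (ha₃ : a₃ ≠ u) (hb : b ≠ u) {F : Finset E} (hd : Disjoint F {e₁, e₂, e₃}) (z : Config E)
    (τ : E → ℕ) (hτ1 : τ e₁ = 1 ∨ τ e₁ = 2) (hτ2 : τ e₂ = 1 ∨ τ e₂ = 2) (hτ3 : τ e₃ = 1 ∨ τ e₃ = 2)
    (hcone : InConeP πpat (cubicOf (partTable ends {e₁, e₂, e₃} e₁ e₂ e₃ t₁ t₂ t₃ o a₁ a₂ a₃ b F z τ))) :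
    0 ≤ typedCount (F ∪ {e₁, e₂, e₃}) z τ (CovForm.K3 (R := ℚ) ends o a₁ a₂ a₃ b) := by
  have hlaw : partLaw {e₁, e₂, e₃} τ (pat ends {e₁, e₂, e₃} e₁ e₂ e₃ t₁ t₂ t₃) =
      starLaw (τ e₁) (τ e₂) (τ e₃) := by
    funext i j k
    exact partLaw_star he₁ he₂ he₃ ht₁ ht₂ ht₃ h12 h13 h23 hd12 hd13 hd23 τ i j k
  refine typedCount_part_nonneg (isPart_star he₁ he₂ he₃ ht₁ ht₂ ht₃ hS) hS (by simp) (by simp) (by simp)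
    hd12 hd13 hd23 (by simpa using ho) (by simpa using ha₁) (by simpa using ha₂) (by simpa using ha₃)
    (by simpa using hb) hd z τ hcone ?_
  rw [hlaw]
  exact typedHarris_star (τ e₁) (τ e₂) (τ e₃) hτ1 hτ2 hτ3

end Main

end Part

end Summit.Ventures.PercRepro2
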